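import Mathlib
import Summits.Ventures.PercRepro2.Defs
import Summits.Ventures.PercRepro2.Independence
import Summits.Ventures.PercRepro2.Graph
import Summits.Ventures.PercRepro2.Induced
import Summits.Ventures.PercRepro2.HullDefs
import Summits.Ventures.PercRepro2.HullFlip
import Summits.Ventures.PercRepro2.HullTheoremA
import Summits.Ventures.PercRepro2.HullTree

/-!
# The per-hull (BASE) at a root separating its neighbours, and at a pendant root
(blind cell PercRepro2, typer-1; lead g10 `LEAD-PROOFSHAPES.md` ADDENDUM 24 (26)(a): "per-hull (BASE)
holds whenever the core is `{l}` for every configuration of the fibre (trees; more generally hulls in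
which `l` is a cut vertex separating all its neighbours)")

* `SeparatesNbrs ends l`: two edges at `l` whose other ends are joined in `G − l` (all edges not
  touching `l` open) are the same edge — `l` is a cut vertex separating all its neighbours, with no
  parallel edges at `l`; `IsPendant ends l e₀`: `e₀` is the only edge at `l`;
* `conn_del_of_walk_avoiding`: a walk of `ζ` avoiding the vertex `l` is a walk of `G − l`;
* **`core_eq_singleton_of_separates`**: under `SeparatesNbrs` the core of every two-colouring is `{l}`
  (a red and a blue path from `l` to `k ≠ l` leave `l` by edges whose other ends are joined in
  `G − l`, so the two edges coincide — but one is red and the other blue);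
* **`Cut.hullTerm_nonneg`**: under `SeparatesNbrs` every per-hull term of (BASE) is nonnegative
  (`coreTrivial_sum_nonneg`); **`Pendant.hullTerm_nonneg`**: the same at a pendant root `l`, on
  EVERY graph; plus the (BASE)/(HULL-OUT) sums on the free fibre.
-/

namespace Summit.Ventures.PercRepro2

namespace Hull

open scoped Classical

variable {V : Type*} {E : Type*}

/-! ## Roots separating their neighbours -/

section Separates

variable {ends : E → Sym2 V}

/-- The all-open configuration with the edges at `l` deleted: the graph `G − l`. -/
noncomputable def delRoot (ends : E → Sym2 V) (l : V) : Config E :=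
  delConfig ends {l} (fun _ => true)

/-- `l` separates all its neighbours: two edges at `l` whose other ends are joined in `G − l` are
equal (in particular there are no parallel edges at `l`). -/
def SeparatesNbrs (ends : E → Sym2 V) (l : V) : Prop :=
  ∀ (e e' : E) (c c' : V), ends e = s(l, c) → ends e' = s(l, c') →
    Conn ends (delRoot ends l) c c' → e = e'

/-- `e₀` is the only edge at `l` (a pendant root). -/
def IsPendant (ends : E → Sym2 V) (l : V) (e₀ : E) : Prop :=
  ∀ e, l ∈ ends e → e = e₀

/-- A pendant root separates its neighbours. -/
lemma separatesNbrs_of_isPendant {l : V} {e₀ : E} (h : IsPendant ends l e₀) :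
    SeparatesNbrs ends l := by
  intro e e' c c' he he' _
  rw [h e (by rw [he]; exact Sym2.mem_mk_left l c), h e' (by rw [he']; exact Sym2.mem_mk_left l c')]

/-- An edge not at `l` is open in `G − l`. -/
lemma delRoot_eq_true {l x y : V} {e : E} (hends : ends e = s(x, y)) (hx : x ≠ l) (hy : y ≠ l) :
    delRoot ends l e = true := by
  unfold delRoot
  rw [delConfig_apply_of_notMem]
  rw [mem_touches_iff_of_ends hends]
  simp [hx, hy]

/-- A walk of `ζ` whose support avoids `l` is a walk of `G − l`. -/
lemma conn_del_of_walk_avoiding {ζ : Config E} {l : V} {x y : V}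
    (w : (openGraph ends ζ).Walk x y) (hl : l ∉ w.support) : Conn ends (delRoot ends l) x y := by
  induction w with
  | nil => exact conn_refl _ _ _
  | @cons u v z hadj w' ih =>
    rw [SimpleGraph.Walk.support_cons, List.mem_cons, not_or] at hl
    have hv : v ≠ l := fun h => hl.2 (h ▸ w'.start_mem_support)
    obtain ⟨_, e, _, hends⟩ := openGraph_adj.1 hadj
    refine conn_trans (conn_of_openAdj ⟨e, delRoot_eq_true hends (Ne.symm hl.1) hv, hends⟩) (ih hl.2)

/-- A path from `l` to `k ≠ l` starts with an edge at `l` whose other end is joined to `k` in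
`G − l`. -/
lemma exists_first_edge {ζ : Config E} {l k : V} (hne : k ≠ l) (hc : Conn ends ζ l k) :
    ∃ (e : E) (c : V), ζ e = true ∧ ends e = s(l, c) ∧ Conn ends (delRoot ends l) c k := by
  obtain ⟨w⟩ := hc
  obtain ⟨p, hp⟩ := w.toPath
  cases p with
  | nil => exact absurd rfl hne
  | @cons _ c _ hadj q =>
    rw [SimpleGraph.Walk.cons_isPath_iff] at hp
    obtain ⟨_, e, he, hends⟩ := openGraph_adj.1 hadj
    exact ⟨e, c, he, hends, conn_del_of_walk_avoiding q hp.2⟩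

/-- Under `SeparatesNbrs`, a vertex red- and blue-connected to `l` is `l`. -/
lemma eq_of_conn_of_conn_blue_of_separates {l : V} (hsep : SeparatesNbrs ends l) {ζ : Config E}
    {k : V} (hR : Conn ends ζ l k) (hB : Conn ends (blue ζ) l k) : k = l := by
  by_contra hne
  obtain ⟨e, c, he, hends, hc⟩ := exists_first_edge hne hR
  obtain ⟨e', c', he', hends', hc'⟩ := exists_first_edge hne hB
  have hee : e = e' := hsep e e' c c' hends hends' (conn_trans hc (conn_symm hc'))
  subst hee
  rw [blue_eq_true_iff] at he'
  rw [he] at he'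
  exact Bool.noConfusion he'

/-- **Under `SeparatesNbrs` the core of every two-colouring is `{l}`.** -/
theorem core_eq_singleton_of_separates {l : V} (hsep : SeparatesNbrs ends l) (ζ : Config E) :
    core ends ζ l = {l} := by
  ext k
  constructor
  · intro hk
    exact eq_of_conn_of_conn_blue_of_separates hsep hk.1 hk.2
  · intro hk
    rw [Set.mem_singleton_iff] at hk
    subst hk
    exact l_mem_core ζ k

end Separates

/-! ## The per-hull (BASE) at a separating root and at a pendant root -/

section Sums

variable [Fintype E] [DecidableEq E] {R : Type*} [Field R] [LinearOrder R] [IsStrictOrderedRing R]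
  {ends : E → Sym2 V}

namespace Cut

omit [LinearOrder R] [IsStrictOrderedRing R] in
/-- Under `SeparatesNbrs` the per-hull term is its core-trivial part. -/
lemma hullTerm_eq_coreTrivialTerm {l : V} (hsep : SeparatesNbrs ends l) (o h b : V) (H : Set V) :
    hullTerm R ends l o h b H = coreTrivialTerm R ends l o h b H := by
  unfold hullTerm coreTrivialTerm
  refine Finset.sum_congr rfl fun ζ _ => ?_
  rw [core_eq_singleton_of_separates hsep ζ]
  simp only [and_true]

/-- **The per-hull (BASE) at a root separating its neighbours** (ADDENDUM 24 (26)(a)):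
`Σ_{ζ : H_l(ζ) = H} s_{o,l}(ζ) · 1[h ∉ H_l] · 1[h ↔_B b] ≥ 0` for every `H`. -/
theorem hullTerm_nonneg {l : V} (hsep : SeparatesNbrs ends l) (o h b : V) (H : Set V) :
    0 ≤ hullTerm R ends l o h b H := by
  rw [hullTerm_eq_coreTrivialTerm hsep]
  exact coreTrivial_sum_nonneg ends l o h b H

/-- (BASE) on the free fibre at a root separating its neighbours. -/
theorem sum_sideSign_outConn_nonneg {l : V} (hsep : SeparatesNbrs ends l) (o h b : V) :
    0 ≤ ∑ ζ : Config E, sideSign R ends ζ l o * outConn R ends l h b ζ := by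
  refine (thmB_conn (R := R) ends l o h b).trans (le_of_eq (Finset.sum_congr rfl fun ζ _ => ?_))
  rw [if_pos (core_eq_singleton_of_separates hsep ζ)]

/-- (HULL-OUT) on the free fibre at a root separating its neighbours. -/
theorem sum_sideSign_outConn₂_nonneg {l : V} (hsep : SeparatesNbrs ends l) (o v w : V) :
    0 ≤ ∑ ζ : Config E, sideSign R ends ζ l o * outConn₂ R ends l v w ζ := by
  refine (thmB_conn_out (R := R) ends l o v w).trans
    (le_of_eq (Finset.sum_congr rfl fun ζ _ => ?_))
  rw [if_pos (core_eq_singleton_of_separates hsep ζ)]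

end Cut

namespace Pendant

/-- **The per-hull (BASE) at a pendant root, on every graph**: if `e₀` is the only edge at `l`,
`Σ_{ζ : H_l(ζ) = H} s_{o,l}(ζ) · 1[h ∉ H_l] · 1[h ↔_B b] ≥ 0` for every `H`. -/
theorem hullTerm_nonneg {l : V} {e₀ : E} (hl : IsPendant ends l e₀) (o h b : V) (H : Set V) :
    0 ≤ hullTerm R ends l o h b H :=
  Cut.hullTerm_nonneg (separatesNbrs_of_isPendant hl) o h b H

/-- (BASE) on the free fibre at a pendant root. -/
theorem sum_sideSign_outConn_nonneg {l : V} {e₀ : E} (hl : IsPendant ends l e₀) (o h b : V) :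
    0 ≤ ∑ ζ : Config E, sideSign R ends ζ l o * outConn R ends l h b ζ :=
  Cut.sum_sideSign_outConn_nonneg (separatesNbrs_of_isPendant hl) o h b

/-- (HULL-OUT) on the free fibre at a pendant root. -/
theorem sum_sideSign_outConn₂_nonneg {l : V} {e₀ : E} (hl : IsPendant ends l e₀) (o v w : V) :
    0 ≤ ∑ ζ : Config E, sideSign R ends ζ l o * outConn₂ R ends l v w ζ :=
  Cut.sum_sideSign_outConn₂_nonneg (separatesNbrs_of_isPendant hl) o v w

end Pendant

end Sums

end Hull

end Summit.Ventures.PercRepro2
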